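import Summits.AtomisticToContinuum.Crystallization.Theses.ChessboardParticlePlanes
import Literature.Algebra.EuclideanLattices.GaussianLatticeSums

/-!
# Crux `ChessboardParticlePlanes.LjPlaneChessboard` (stmt-AtomisticToContinuum-6709), line `Sketch`,
# stub `stub_modeExpansionOfFourier` — planar mode expansion of a Yukawa slice over a rank-2
# lattice, granted its Fourier transform

For a full lattice `L` of a `2`-dimensional real inner-product space `V`, `m > 0`, `u > 0` and
`x ∈ V`, the Yukawa slice summed over the shifted lattice has the mode (Poisson) expansion
`Σ_{λ ∈ L} e^{−m√(‖x−λ‖²+u²)}/√(‖x−λ‖²+u²)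
   = (2π / covol L) · Σ_{w ∈ L*} e^{−u√(m²+(2π‖w‖)²)}/√(m²+(2π‖w‖)²) · cos(2π⟪x,w⟫)`,
both sides converging absolutely — GRANTED the Sommerfeld–Weyl formula for the planar Fourier
transform of the slice, `𝓕[e^{−m√(‖·−x‖²+u²)}/√(‖·−x‖²+u²)](w) = 𝐞(−⟪x,w⟫) · 2π e^{−uκ_w}/κ_w`,
`κ_w = √(m²+(2π‖w‖)²)`, which enters as a hypothesis (it is the neighbouring stub
`stub_yukawaSliceFourier` of the skeleton).

The proof is bookkeeping around the tree's Poisson summation formula for full lattices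
(`Literature.NumberTheory.LFunctions.Fourier.tsum_eq_tsum_fourier_of_rpow_decay`, Neukirch VII
(3.2), decay form): the slice is continuous (its denominator is `≥ u > 0`) and is dominated by
`e^{−m‖v−x‖}/u`, hence by a multiple of `(1+‖v‖)⁻³` (`exp_neg_mul_le_rpow_neg_three`:
`e^{−ms} ≤ (6e^{m}/m³)(1+s)⁻³`, from `(m(1+s))³/3! ≤ e^{m(1+s)}`); the Fourier side is dominated by
`(2π/m) e^{−2πu‖w‖}`, hence summable over the dual lattice
(`Literature.NumberTheory.LFunctions.Fourier.summable_of_decay_zlattice`); and the real part of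
`𝐞(−t) · r` is `r cos(2πt)`, exactly as in the Gaussian model
`Literature.Algebra.EuclideanLattices.tsum_gaussianFunction_sub_eq`.

Main results: `modeExpansion_of_fourier` (one space `V`, the Fourier transform of the slice as a
hypothesis) and `stub_modeExpansionOfFourier` (the registered signature of the skeleton).
-/

noncomputable section

namespace Summit.AtomisticToContinuum.Crystallization.Theorems.ChessboardParticlePlanesLjPlaneChessboard

open Literature.Algebra.EuclideanLattices
open scoped Real InnerProductSpace FourierTransform

/-! ### Scalar inequalities -/

/-- Exponential decay dominates cubic decay: `e^{-m s} ≤ (6 e^{m} / m³) (1 + s)⁻³` for `m > 0`,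
`s ≥ 0` (from `(m(1+s))³/3! ≤ e^{m(1+s)}`, Mathlib `Real.pow_div_factorial_le_exp`). [folklore] -/
theorem exp_neg_mul_le_rpow_neg_three {m : ℝ} (hm : 0 < m) {s : ℝ} (hs : 0 ≤ s) :
    Real.exp (-(m * s)) ≤ 6 * Real.exp m / m ^ 3 * (1 + s) ^ (-(3 : ℝ)) := by
  have h1 : (m * (1 + s)) ^ 3 / (Nat.factorial 3 : ℕ) ≤ Real.exp (m * (1 + s)) :=
    Real.pow_div_factorial_le_exp (m * (1 + s)) (by positivity) 3
  have h6 : ((Nat.factorial 3 : ℕ) : ℝ) = 6 := by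
    rw [show Nat.factorial 3 = 6 by rfl]; norm_num
  rw [h6, div_le_iff₀ (by norm_num : (0 : ℝ) < 6)] at h1
  have key : (m * (1 + s)) ^ 3 ≤ 6 * (Real.exp m * Real.exp (m * s)) := by
    rw [← Real.exp_add, show m + m * s = m * (1 + s) by ring]
    linarith
  have hs1 : 0 < 1 + s := by linarith
  rw [Real.rpow_neg hs1.le, show (3 : ℝ) = ((3 : ℕ) : ℝ) by norm_num, Real.rpow_natCast,
    show 6 * Real.exp m / m ^ 3 * ((1 + s) ^ 3)⁻¹ = 6 * Real.exp m / (m ^ 3 * (1 + s) ^ 3) by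
      field_simp,
    le_div_iff₀ (by positivity)]
  have hms : Real.exp (-(m * s)) * Real.exp (m * s) = 1 := by
    rw [← Real.exp_add, neg_add_cancel, Real.exp_zero]
  calc Real.exp (-(m * s)) * (m ^ 3 * (1 + s) ^ 3)
      = Real.exp (-(m * s)) * (m * (1 + s)) ^ 3 := by ring
    _ ≤ Real.exp (-(m * s)) * (6 * (Real.exp m * Real.exp (m * s))) := by gcongr
    _ = 6 * Real.exp m * (Real.exp (-(m * s)) * Real.exp (m * s)) := by ring
    _ = 6 * Real.exp m := by rw [hms, mul_one]

/-- The Yukawa slice against the bare exponential: `e^{-m√(a²+u²)}/√(a²+u²) ≤ e^{-ma}/u` for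
`m > 0`, `u > 0`, `a ≥ 0` (since `√(a²+u²) ≥ max(a,u)`). [folklore] -/
theorem exp_neg_mul_sqrt_div_sqrt_le {m u a : ℝ} (hm : 0 < m) (hu : 0 < u) (ha : 0 ≤ a) :
    Real.exp (-(m * Real.sqrt (a ^ 2 + u ^ 2))) / Real.sqrt (a ^ 2 + u ^ 2) ≤
      Real.exp (-(m * a)) / u := by
  have h1 : a ≤ Real.sqrt (a ^ 2 + u ^ 2) := by
    calc a = Real.sqrt (a ^ 2) := (Real.sqrt_sq ha).symm
      _ ≤ Real.sqrt (a ^ 2 + u ^ 2) := Real.sqrt_le_sqrt (by nlinarith [sq_nonneg u])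
  have h2 : u ≤ Real.sqrt (a ^ 2 + u ^ 2) := by
    calc u = Real.sqrt (u ^ 2) := (Real.sqrt_sq hu.le).symm
      _ ≤ Real.sqrt (a ^ 2 + u ^ 2) := Real.sqrt_le_sqrt (by nlinarith [sq_nonneg a])
  gcongr

/-- The dual-side coefficient against the bare exponential:
`e^{-u√(m²+(2πt)²)}/√(m²+(2πt)²) ≤ e^{-2πu t}/m` for `m > 0`, `u > 0`, `t ≥ 0`. [folklore] -/
theorem exp_neg_mul_sqrt_div_sqrt_dual_le {m u t : ℝ} (hm : 0 < m) (hu : 0 < u) (ht : 0 ≤ t) :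
    Real.exp (-(u * Real.sqrt (m ^ 2 + (2 * π * t) ^ 2))) / Real.sqrt (m ^ 2 + (2 * π * t) ^ 2) ≤
      Real.exp (-(2 * π * u * t)) / m := by
  have h := exp_neg_mul_sqrt_div_sqrt_le (a := 2 * π * t) hu hm (by positivity)
  rw [add_comm ((2 * π * t) ^ 2) (m ^ 2), show u * (2 * π * t) = 2 * π * u * t by ring] at h
  exact h

/-- Real part of a real number twisted by the Fourier character: `Re(𝐞(-t) · (a e / s)) =
a · (e / s · cos(2πt))`. [folklore] -/
theorem re_fourierChar_neg_smul_ofReal (t a e s : ℝ) :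
    (𝐞 (-t) • (((a * e / s : ℝ)) : ℂ)).re = a * (e / s * Real.cos (2 * π * t)) := by
  rw [Circle.smul_def, Real.fourierChar_apply, smul_eq_mul, mul_comm, Complex.re_ofReal_mul,
    Complex.exp_ofReal_mul_I_re, show 2 * π * -t = -(2 * π * t) by ring, Real.cos_neg]
  ring

/-! ### The slice and its Fourier side: continuity and decay -/

/-- The Yukawa slice `v ↦ e^{-m√(‖v-x‖²+u²)}/√(‖v-x‖²+u²)` (as a complex-valued function) is
continuous for `u > 0`: its denominator is `≥ u > 0`. [folklore] -/
theorem continuous_yukawaSlice {E : Type*} [NormedAddCommGroup E] (m : ℝ) {u : ℝ} (hu : 0 < u)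
    (x : E) :
    Continuous fun v : E =>
      ((Real.exp (-(m * Real.sqrt (‖v - x‖ ^ 2 + u ^ 2))) /
          Real.sqrt (‖v - x‖ ^ 2 + u ^ 2) : ℝ) : ℂ) := by
  refine Complex.continuous_ofReal.comp ?_
  refine Continuous.div (by fun_prop) (by fun_prop) fun v => ?_
  exact (Real.sqrt_pos.2 (by positivity)).ne'

/-- Decay of the Yukawa slice against powers:
`|e^{-m√(‖v-x‖²+u²)}/√(‖v-x‖²+u²)| ≤ (6 e^{m} e^{m‖x‖} / (m³ u)) (1+‖v‖)⁻³`. [folklore] -/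
theorem norm_yukawaSlice_le {E : Type*} [NormedAddCommGroup E] {m u : ℝ} (hm : 0 < m) (hu : 0 < u)
    (x v : E) :
    ‖((Real.exp (-(m * Real.sqrt (‖v - x‖ ^ 2 + u ^ 2))) /
        Real.sqrt (‖v - x‖ ^ 2 + u ^ 2) : ℝ) : ℂ)‖ ≤
      6 * Real.exp m / m ^ 3 * Real.exp (m * ‖x‖) / u * (1 + ‖v‖) ^ (-(3 : ℝ)) := by
  rw [Complex.norm_real, Real.norm_of_nonneg (by positivity)]
  have hshift : Real.exp (-(m * ‖v - x‖)) ≤ Real.exp (m * ‖x‖) * Real.exp (-(m * ‖v‖)) := by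
    rw [← Real.exp_add, Real.exp_le_exp]
    have h := mul_le_mul_of_nonneg_left (norm_le_norm_sub_add v x) hm.le
    linarith
  calc Real.exp (-(m * Real.sqrt (‖v - x‖ ^ 2 + u ^ 2))) / Real.sqrt (‖v - x‖ ^ 2 + u ^ 2)
      ≤ Real.exp (-(m * ‖v - x‖)) / u := exp_neg_mul_sqrt_div_sqrt_le hm hu (norm_nonneg _)
    _ ≤ Real.exp (m * ‖x‖) * Real.exp (-(m * ‖v‖)) / u := by gcongr
    _ ≤ Real.exp (m * ‖x‖) * (6 * Real.exp m / m ^ 3 * (1 + ‖v‖) ^ (-(3 : ℝ))) / u := by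
        gcongr
        exact exp_neg_mul_le_rpow_neg_three hm (norm_nonneg v)
    _ = 6 * Real.exp m / m ^ 3 * Real.exp (m * ‖x‖) / u * (1 + ‖v‖) ^ (-(3 : ℝ)) := by ring

/-- Decay of the Fourier side against powers: `‖𝐞(-⟪x,w⟫) · 2π e^{-uκ_w}/κ_w‖ ≤ C' (1+‖w‖)⁻³`
with `κ_w = √(m²+(2π‖w‖)²)` and `C' = (2π/m) · 6 e^{2πu}/(2πu)³`. [folklore] -/
theorem norm_fourierYukawaSlice_le {E : Type*} [NormedAddCommGroup E] [InnerProductSpace ℝ E]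
    {m u : ℝ} (hm : 0 < m) (hu : 0 < u) (x w : E) :
    ‖𝐞 (-⟪x, w⟫_ℝ) •
        (((2 * π * Real.exp (-(u * Real.sqrt (m ^ 2 + (2 * π * ‖w‖) ^ 2))) /
            Real.sqrt (m ^ 2 + (2 * π * ‖w‖) ^ 2) : ℝ)) : ℂ)‖ ≤
      2 * π / m * (6 * Real.exp (2 * π * u) / (2 * π * u) ^ 3) * (1 + ‖w‖) ^ (-(3 : ℝ)) := by
  rw [Circle.norm_smul, Complex.norm_real, Real.norm_of_nonneg (by positivity)]
  have h1 := exp_neg_mul_sqrt_div_sqrt_dual_le hm hu (norm_nonneg w)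
  have h2 := exp_neg_mul_le_rpow_neg_three (m := 2 * π * u) (by positivity) (norm_nonneg w)
  calc 2 * π * Real.exp (-(u * Real.sqrt (m ^ 2 + (2 * π * ‖w‖) ^ 2))) /
        Real.sqrt (m ^ 2 + (2 * π * ‖w‖) ^ 2)
      = 2 * π * (Real.exp (-(u * Real.sqrt (m ^ 2 + (2 * π * ‖w‖) ^ 2))) /
          Real.sqrt (m ^ 2 + (2 * π * ‖w‖) ^ 2)) := by ring
    _ ≤ 2 * π * (Real.exp (-(2 * π * u * ‖w‖)) / m) := by gcongr
    _ ≤ 2 * π * (6 * Real.exp (2 * π * u) / (2 * π * u) ^ 3 * (1 + ‖w‖) ^ (-(3 : ℝ)) / m) := by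
        gcongr
    _ = 2 * π / m * (6 * Real.exp (2 * π * u) / (2 * π * u) ^ 3) * (1 + ‖w‖) ^ (-(3 : ℝ)) := by
        ring

/-! ### The mode expansion -/

/-- **Mode expansion of a Yukawa slice over a full lattice of a plane, granted its Fourier
transform** (one space `V`): if `𝓕[e^{−m√(‖·−x‖²+u²)}/√(‖·−x‖²+u²)](w) = 𝐞(−⟪x,w⟫) 2π e^{−uκ_w}/κ_w`
for all `w`, `κ_w = √(m²+(2π‖w‖)²)`, then for every full lattice `L` of the `2`-dimensional space
`V` both mode sums converge and
`Σ_{λ ∈ L} e^{−m√(‖x−λ‖²+u²)}/√(‖x−λ‖²+u²) = (2π/covol L) Σ_{w ∈ L*} e^{−uκ_w}/κ_w cos(2π⟪x,w⟫)`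
(Poisson summation `tsum_eq_tsum_fourier_of_rpow_decay` and real parts).
[folklore; cf. GiulianiLebowitzLieb2006 §3] -/
theorem modeExpansion_of_fourier {V : Type*} [NormedAddCommGroup V] [InnerProductSpace ℝ V]
    [FiniteDimensional ℝ V] [MeasurableSpace V] [BorelSpace V] {m u : ℝ} {x : V}
    (hF : ∀ w : V,
        𝓕 (fun v : V =>
            ((Real.exp (-(m * Real.sqrt (‖v - x‖ ^ 2 + u ^ 2))) /
                Real.sqrt (‖v - x‖ ^ 2 + u ^ 2) : ℝ) : ℂ)) w =
          𝐞 (-⟪x, w⟫_ℝ) •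
            (((2 * π * Real.exp (-(u * Real.sqrt (m ^ 2 + (2 * π * ‖w‖) ^ 2))) /
                Real.sqrt (m ^ 2 + (2 * π * ‖w‖) ^ 2) : ℝ)) : ℂ))
    (hV : Module.finrank ℝ V = 2) (L : Submodule ℤ V) [DiscreteTopology L] [IsZLattice ℝ L]
    (hm : 0 < m) (hu : 0 < u) :
    Summable (fun l : L =>
        Real.exp (-(m * Real.sqrt (‖x - l‖ ^ 2 + u ^ 2))) / Real.sqrt (‖x - l‖ ^ 2 + u ^ 2)) ∧
    Summable (fun w : dualLattice L =>
        Real.exp (-(u * Real.sqrt (m ^ 2 + (2 * π * ‖(w : V)‖) ^ 2))) /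
            Real.sqrt (m ^ 2 + (2 * π * ‖(w : V)‖) ^ 2) *
          Real.cos (2 * π * ⟪x, (w : V)⟫_ℝ)) ∧
    ∑' l : L, Real.exp (-(m * Real.sqrt (‖x - l‖ ^ 2 + u ^ 2))) / Real.sqrt (‖x - l‖ ^ 2 + u ^ 2) =
      2 * π / ZLattice.covolume L *
        ∑' w : dualLattice L,
          Real.exp (-(u * Real.sqrt (m ^ 2 + (2 * π * ‖(w : V)‖) ^ 2))) /
              Real.sqrt (m ^ 2 + (2 * π * ‖(w : V)‖) ^ 2) *
            Real.cos (2 * π * ⟪x, (w : V)⟫_ℝ) := by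
  have hb : (Module.finrank ℝ V : ℝ) < 3 := by rw [hV]; norm_num
  have hcont := continuous_yukawaSlice (E := V) m hu x
  have hdec := fun v : V => norm_yukawaSlice_le hm hu x v
  -- summability of the Fourier side over the dual lattice, from its exponential decay
  have hsum : Summable fun w : dualLattice L =>
      𝓕 (fun v : V =>
        ((Real.exp (-(m * Real.sqrt (‖v - x‖ ^ 2 + u ^ 2))) /
            Real.sqrt (‖v - x‖ ^ 2 + u ^ 2) : ℝ) : ℂ)) (w : V) :=
    Literature.NumberTheory.LFunctions.Fourier.summable_of_decay_zlattice (dualLattice L) hb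
      fun w => by rw [hF w]; exact norm_fourierYukawaSlice_le hm hu x w
  -- Poisson summation
  have key := Literature.NumberTheory.LFunctions.Fourier.tsum_eq_tsum_fourier_of_rpow_decay L
    hcont hb hdec hsum
  -- real parts
  have h := congrArg Complex.re key
  rw [← Complex.ofReal_tsum, Complex.ofReal_re, Complex.smul_re, smul_eq_mul,
    Complex.re_tsum hsum] at h
  simp_rw [hF, re_fourierChar_neg_smul_ofReal] at h
  rw [tsum_mul_left] at h
  -- summability of the real parts of the Fourier side
  have hre := (Complex.hasSum_re hsum.hasSum).summable
  simp_rw [hF, re_fourierChar_neg_smul_ofReal] at hre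
  have h2π : (2 * π : ℝ) ≠ 0 := by positivity
  refine ⟨?_, ?_, ?_⟩
  · -- the lattice side: absolutely convergent by the decay of the slice
    have hL := Literature.NumberTheory.LFunctions.Fourier.summable_of_decay_zlattice L hb hdec
    exact (Complex.summable_ofReal.1 hL).congr fun l => by rw [norm_sub_rev]
  · exact (hre.mul_left (2 * π)⁻¹).congr fun w => inv_mul_cancel_left₀ h2π _
  · refine (tsum_congr fun l => ?_).trans (h.trans (by ring))
    rw [norm_sub_rev]

/-- **Stub 12b — planar mode expansion of a Yukawa slice over a rank-2 lattice, granted the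
Sommerfeld–Weyl transform (M, bookkeeping).**  For a full lattice `L` of a `2`-dimensional real
inner-product space, `m > 0`, `u > 0` and `x`: both sides are summable and
`Σ_{λ ∈ L} e^{−m√(‖x−λ‖²+u²)}/√(‖x−λ‖²+u²) = (2π / covol L) · Σ_{w ∈ L*} e^{−u√(m²+(2π‖w‖)²)}/√(m²+(2π‖w‖)²) · cos(2π⟪x,w⟫)`.
Route: the tree's Poisson summation formula for full lattices
`Literature.NumberTheory.LFunctions.Fourier.tsum_eq_tsum_fourier_of_rpow_decay` applied to the
(continuous, exponentially decaying) slice, the hypothesis for its Fourier transform, summability of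
the dual side by `Fourier.summable_of_decay_zlattice`, and real parts as in
`tsum_gaussianFunction_sub_eq` (`modeExpansion_of_fourier`). [folklore; cf. GiulianiLebowitzLieb2006 §3] -/
theorem stub_modeExpansionOfFourier :
    (∀ (V : Type) [NormedAddCommGroup V] [InnerProductSpace ℝ V] [FiniteDimensional ℝ V]
      [MeasurableSpace V] [BorelSpace V],
      Module.finrank ℝ V = 2 →
      ∀ (m u : ℝ) (x w : V), 0 < m → 0 < u →
        𝓕 (fun v : V =>
            ((Real.exp (-(m * Real.sqrt (‖v - x‖ ^ 2 + u ^ 2))) /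
                Real.sqrt (‖v - x‖ ^ 2 + u ^ 2) : ℝ) : ℂ)) w =
          𝐞 (-⟪x, w⟫_ℝ) •
            (((2 * π * Real.exp (-(u * Real.sqrt (m ^ 2 + (2 * π * ‖w‖) ^ 2))) /
                Real.sqrt (m ^ 2 + (2 * π * ‖w‖) ^ 2) : ℝ)) : ℂ)) →
    ∀ (V : Type) [NormedAddCommGroup V] [InnerProductSpace ℝ V] [FiniteDimensional ℝ V]
      [MeasurableSpace V] [BorelSpace V] (L : Submodule ℤ V) [DiscreteTopology L] [IsZLattice ℝ L],
      Module.finrank ℝ V = 2 →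
      ∀ (m u : ℝ) (x : V), 0 < m → 0 < u →
        Summable (fun l : L =>
            Real.exp (-(m * Real.sqrt (‖x - l‖ ^ 2 + u ^ 2))) / Real.sqrt (‖x - l‖ ^ 2 + u ^ 2)) ∧
        Summable (fun w : dualLattice L =>
            Real.exp (-(u * Real.sqrt (m ^ 2 + (2 * π * ‖(w : V)‖) ^ 2))) /
                Real.sqrt (m ^ 2 + (2 * π * ‖(w : V)‖) ^ 2) *
              Real.cos (2 * π * ⟪x, (w : V)⟫_ℝ)) ∧
        ∑' l : L, Real.exp (-(m * Real.sqrt (‖x - l‖ ^ 2 + u ^ 2))) / Real.sqrt (‖x - l‖ ^ 2 + u ^ 2) =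
          2 * π / ZLattice.covolume L *
            ∑' w : dualLattice L,
              Real.exp (-(u * Real.sqrt (m ^ 2 + (2 * π * ‖(w : V)‖) ^ 2))) /
                  Real.sqrt (m ^ 2 + (2 * π * ‖(w : V)‖) ^ 2) *
                Real.cos (2 * π * ⟪x, (w : V)⟫_ℝ) := by
  intro hF V _ _ _ _ _ L _ _ hV m u x hm hu
  exact modeExpansion_of_fourier (fun w => hF V hV m u x w hm hu) hV L hm hu

end Summit.AtomisticToContinuum.Crystallization.Theorems.ChessboardParticlePlanesLjPlaneChessboard

end
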